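import Literature.NumberTheory.LFunctions.TaoLogChowlaMoebius
import Literature.NumberTheory.LFunctions.LiouvilleNonpretentious
import Literature.NumberTheory.LFunctions.TaoLogElliottProp24
import HarnessLib

/-!
# Log-averaged two-point Chowla for Möbius: assembly of the proof DAG

`Literature.NumberTheory.Sieve.tao_log_chowla_moebius` (Tao, Forum Math. Pi 4 (2016) e8, §1 after Remark 1.6:
`∑_{n ≤ x} μ(n)μ(n+h)/n = o(log x)`) was reduced in `TaoLogChowlaMoebius.lean` to Tao's
Theorem 1.3 (`Literature.NumberTheory.LFunctions.tao_log_averaged_elliott_two`) and the non-pretentiousness of `λ` at every level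
(`Literature.NumberTheory.LFunctions.Tao2016_liouvilleNonpretentious`, hypothesis (1.6)/(1.8) for `λ`, equivalently for `μ`).  The
latter is now a theorem (`Literature.NumberTheory.LFunctions.Tao2016_liouvilleNonpretentious_holds`, `LiouvilleNonpretentious.lean`),
so the Möbius case of the logarithmically averaged Chowla conjecture depends on exactly one named
fact of the tree, Tao's Theorem 1.3, which in turn (`TaoLogElliottProp24.lean`,
`Literature.NumberTheory.LFunctions.tao_log_averaged_elliott_two_of_MRT_core`: §2 reduction and Proposition 2.4 proved) rests on
the two remaining named facts `Literature.NumberTheory.LFunctions.MatomakiRadziwillTao2015_theorem17` (Matomäki–Radziwiłł–Tao 2015,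
Theorem 1.7) and `Literature.NumberTheory.LFunctions.Tao2016_theorem23_core` (Tao 2016, the proof of Theorem 2.3 after (2.10)):

* `Literature.Parity.tao_log_chowla_moebius_of_elliott_two :
    tao_log_averaged_elliott_two → Parity.tao_log_chowla_moebius`;
* `Literature.Parity.tao_log_chowla_moebius_of_MRT_core :
    MatomakiRadziwillTao2015_theorem17 → Tao2016_theorem23_core → Parity.tao_log_chowla_moebius`.

(The alternative route through the Liouville case, `Literature.NumberTheory.LFunctions.tao_log_chowla_moebius_of_liouville`
in `TaoLogChowlaMoebiusOfLiouville.lean`, ends at the same fact, since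
`Literature.NumberTheory.LFunctions.tao_log_chowla_liouville_of_facts` also consumes Theorem 1.3.)

## References
* T. Tao, *The logarithmically averaged Chowla and Elliott conjectures for two-point
  correlations*, Forum Math. Pi 4 (2016), e8; arXiv:1509.05422, §1 (Theorem 1.3, Corollary 1.5 and
  the paragraph after Remark 1.6).
-/

namespace Literature.NumberTheory.LFunctions

/-- **`μ`-log-Chowla from Tao's Theorem 1.3 alone.**  Tao 2016, §1 after Remark 1.6 ("Corollary
1.5 also implies `∑ g₁(n)g₂(n+1)/n = o(log x)` when … at least one of `g₁, g₂` is equal to `μ` …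
Thus `∑ μ(n)μ(n+1)/n = o(log x)`"), with the hypothesis (1.6)/(1.8) for `μ` (= for `λ`, as `μ` and
`λ` agree on primes) supplied by `Tao2016_liouvilleNonpretentious_holds`.
[cite: TaoFMP2016, §1 (paragraph after Remark 1.6)] -/
theorem tao_log_chowla_moebius_of_elliott_two (hE : tao_log_averaged_elliott_two) :
    Sieve.tao_log_chowla_moebius :=
  LFunctions.tao_log_chowla_moebius_of_elliott hE Tao2016_liouvilleNonpretentious_holds

/-- **`μ`-log-Chowla from the two remaining named facts of the DAG**: the Matomäki–Radziwiłł–Tao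
exponential sum estimate (MRT 2015, Thm 1.7) and the core of the proof of Tao's Theorem 2.3
(Tao 2016, §2 after (2.10), §§3–4).  [cite: TaoFMP2016, §1 (paragraph after Remark 1.6)] -/
theorem tao_log_chowla_moebius_of_MRT_core (hMRT : MatomakiRadziwillTao2015_theorem17)
    (hcore : Tao2016_theorem23_core) : Sieve.tao_log_chowla_moebius :=
  LFunctions.tao_log_chowla_moebius_of_elliott_two (tao_log_averaged_elliott_two_of_MRT_core hMRT hcore)

end Literature.NumberTheory.LFunctions
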